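import Mathlib
import Summits.QuantumFields.QCD.Theses.EulerDescent
import Literature.MathematicalPhysics.QuantumFieldTheory.QCDGoldstoneBound

/-!
# The UPPER LOCATOR `stub_offsetBoundedAbove` of line `bounded_locator` (crux `EulerDescent.HonestHeavyAnchor`,
# item stmt-QuantumFields-16901) IS heavy-quark decoupling along a subsequence — the kernel-checked reduction

Helper file (def-free, sorry-free) of worker `stub_offsetBoundedAbove` (lead prover-line-stmt-QuantumFields-16901-0,
cycle 1).  The registered stub says: for `N_f ∈ {2,3}` and every mass-scaling, asymptotically scaling regularisation
`reg` with a closing intrinsic Wilson corner `mc` (eventually the least upper bound of the non-massive degenerate bare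
masses at `β_k`, `mc k → 0`) carrying the heavy body above `M`, the renormalised corner offset
`(m_crit(k) − mc(k))·Z_m(k)/a_k` is EVENTUALLY BOUNDED ABOVE.  It is open-problem grade.  This file strips it of
all order / filter / subsequence bookkeeping and isolates the physics as ONE decoupling statement, written over the
Statement's vocabulary only (hypothesis `hdec` of `offsetBoundedAbove_of_heavyChannelDecoupling`, no `def`):

  **Heavy-channel decoupling.**  For `N_f ∈ {2,3}`, a mass-scaling `reg`, a closing corner `mc` of its couplings,
  a tuple `m`, species renormalisations `z, shift`, OS data `T` and `Δ > 0`: if the corner offset tends to `+∞`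
  along the WHOLE sequence, `IsQCDAlong (reg.scheme m z shift) T`, and both the lattice scheme and `T` have the gap
  `Δ`, then the flavour-changing pseudoscalar `pseudoRe f g` (`f ≠ g`) is NOT a non-trivial field of `T`.

  (Mechanism, not formalised: the quarks realised at the tuple `m` have corner-relative RGI masses
  `offset + m_f → +∞`; by Lüscher's positive transfer matrix (`m_f(k) > −1`, part of `IsQCDAlong`) the RP-diagonal
  pseudoscalar time-slice correlator is a positive-type sequence whose spectral support recedes to `+∞` in physical
  units; convergence at two separations then forces the limit two-point function to vanish —
  `Theorems/EulerDescentHonestHeavyAnchorDecoupling.lean`, `laplace_limit_eq_zero_of_receding_support` /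
  `spectralSum_limit_eq_zero_of_receding_spectrum` — independently of the free multiplicative renormalisation
  `z`, and flavour symmetry kills the one-point function, so `IsNontrivial (pseudoRe f g)` fails.  The open input is
  the RATE: a spectral bound at the RENORMALISED, corner-relative quark mass; configuration-wise bounds
  (`Literature.MathematicalPhysics.QuantumLattice.norm_inv_wilsonDirac_apply_le`, items stmt-QuantumFields-8696/8697)
  see only the bare mass — `Literature.Barriers.QuantumFields.VafaWittenEigenvalueBound`; the closest registered
  item, stmt-QuantumFields-8693 `RenormalisedVafaWitten.RenormalisedQuarkLineBound`, measures its rate from the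
  regularisation's own threshold `M₀(reg)`, not from the intrinsic corner, so it does not supply the divergence.)

`offsetBoundedAbove_of_heavyChannelDecoupling : decoupling → stub_offsetBoundedAbove` (the stub's registered
statement verbatim as the consequent).  Proof: if the offset is not eventually bounded above, a strictly increasing
`φ` with `offset ∘ φ → +∞` exists (`exists_subseq_tendsto_atTop_of_not_eventually_le`, from
`Filter.extraction_forall_of_frequently`); the body at the tuple `M + 1` yields `z, shift, T, Δ` with
`T.IsNontrivial (pseudoRe 0 1)`; every clause is a tail property, so it passes to the restricted regularisation
`reg.restrict φ` (`QCDRegularisation.restrict`, Literature `QCDGoldstoneBound`; the lattice Schwinger functions and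
lattice correlators of the reindexed scheme are those of the original at step `φ j`, definitionally); decoupling for
`reg.restrict φ` contradicts non-triviality.  Hence any proof of heavy-channel decoupling closes the stub, and the
stub carries no content beyond it plus this bookkeeping.
-/

noncomputable section

namespace Summit.QuantumFields.QCD.Theorems.HonestHeavyAnchorUpperLocator

open Filter Topology
open Literature.MathematicalPhysics.QuantumFieldTheory

variable {Nf : ℕ}

/-- **A real sequence that is not eventually bounded above has a subsequence tending to `+∞`.** [folklore] -/
theorem exists_subseq_tendsto_atTop_of_not_eventually_le (x : ℕ → ℝ)
    (h : ¬ ∃ M : ℝ, ∀ᶠ k in atTop, x k ≤ M) :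
    ∃ φ : ℕ → ℕ, StrictMono φ ∧ Tendsto (x ∘ φ) atTop atTop := by
  have hfreq : ∀ N : ℕ, ∃ᶠ k in atTop, (N : ℝ) < x k := fun N =>
    (not_eventually.1 (not_exists.1 h (N : ℝ))).mono fun _ hk => not_le.1 hk
  obtain ⟨φ, hφ, hN⟩ := extraction_forall_of_frequently hfreq
  exact ⟨φ, hφ, tendsto_atTop_mono (fun n => (hN n).le) tendsto_natCast_atTop_atTop⟩

/-- For `N_f = 2, 3` there are two distinct flavours. [folklore] -/
theorem exists_flavour_pair_ne (hNf : Nf = 2 ∨ Nf = 3) : ∃ f g : Fin Nf, f ≠ g := by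
  rcases hNf with rfl | rfl <;> exact ⟨0, 1, by decide⟩

/-- **The upper locator from heavy-channel decoupling.**  Hypothesis `hdec` (HEAVY-CHANNEL DECOUPLING, open): for
`N_f ∈ {2,3}`, a mass-scaling regularisation `reg`, an eventual intrinsic corner `mc` of its couplings with `mc → 0`,
a tuple `m`, species renormalisations `z, shift`, OS data `T`, `Δ > 0` and flavours `f ≠ g` — if the renormalised
corner offset `(m_crit(k) − mc(k))·Z_m(k)/a_k → +∞`, `IsQCDAlong (reg.scheme m z shift) T`, the scheme has the
uniform lattice gap `Δ` and `T` the gap `Δ`, then `¬ T.IsNontrivial (QCDField.pseudoRe f g)`.  Conclusion: the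
registered stub `stub_offsetBoundedAbove` verbatim (the offset of every mass-scaling, asymptotically scaling,
closing-cornered, body-carrying regularisation is eventually bounded above).  Proof: subsequence extraction,
heredity of every clause along `reg.restrict φ`, the body at the tuple `M + 1`, flavours `0 ≠ 1`. [folklore] -/
theorem offsetBoundedAbove_of_heavyChannelDecoupling :
    (∀ Nf : ℕ, Nf = 2 ∨ Nf = 3 → ∀ (reg : QCDRegularisation Nf) (mc : ℕ → ℝ) (m : Fin Nf → ℝ)
      (z shift : QCDField Nf → ℕ → ℝ) (T : OSData (QCDField Nf) 4) (Δ : ℝ) (f g : Fin Nf), f ≠ g → 0 < Δ →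
      reg.HasMassScaling →
      (∀ᶠ k in atTop, IsLUB {μ : ℝ | ¬ (∀ (R R' : ℕ) (A : QCDLatticeObservable Nf R)
        (B : QCDLatticeObservable Nf R'), ∃ (C δ : ℝ) (S₀ : ℕ), 0 < δ ∧ ∀ S : ℕ, S₀ ≤ S → ∀ n : ℕ, n ≤ S →
          ‖qcdLatticeConnectedCorr (reg.β k) (2 * S + 1) (fun _ : Fin Nf => μ) A B n‖ ≤ C * Real.exp (-(δ * n)))} (mc k)) →
      Tendsto mc atTop (𝓝 0) →
      Tendsto (fun k => (reg.mcrit k - mc k) * reg.Zm k / reg.a k) atTop atTop →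
      IsQCDAlong (reg.scheme m z shift) T → (reg.scheme m z shift).HasLatticeMassGap Δ → T.HasMassGap Δ →
      ¬ T.IsNontrivial (QCDField.pseudoRe f g)) →
    ∀ Nf : ℕ, Nf = 2 ∨ Nf = 3 → ∀ (reg : QCDRegularisation Nf) (mc : ℕ → ℝ) (M : ℝ), reg.HasMassScaling →
      (reg.scheme 0 0 0).HasAsymptoticScaling →
      (∀ᶠ k in atTop, IsLUB {μ : ℝ | ¬ (∀ (R R' : ℕ) (A : QCDLatticeObservable Nf R)
        (B : QCDLatticeObservable Nf R'), ∃ (C δ : ℝ) (S₀ : ℕ), 0 < δ ∧ ∀ S : ℕ, S₀ ≤ S → ∀ n : ℕ, n ≤ S →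
          ‖qcdLatticeConnectedCorr (reg.β k) (2 * S + 1) (fun _ : Fin Nf => μ) A B n‖ ≤ C * Real.exp (-(δ * n)))} (mc k)) →
      Tendsto mc atTop (𝓝 0) →
      (∀ m : Fin Nf → ℝ, (∀ f, M < m f) → ∃ (z shift : QCDField Nf → ℕ → ℝ) (T : OSData (QCDField Nf) 4),
        IsQCDAlong (reg.scheme m z shift) T ∧ T.IsNontrivial QCDField.glue ∧ T.IsNonGaussian QCDField.glue ∧
          (∀ f g : Fin Nf, f ≠ g → T.IsNontrivial (QCDField.pseudoRe f g)) ∧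
            ∃ Δ > 0, T.HasMassGap Δ ∧ (reg.scheme m z shift).HasLatticeMassGap Δ) →
      ∃ M₂ : ℝ, ∀ᶠ k in atTop, (reg.mcrit k - mc k) * reg.Zm k / reg.a k ≤ M₂ := by
  intro hdec Nf hNf reg mc M hms _haf hcorner hmc hbody
  by_contra hnot
  -- a subsequence along which the offset diverges to `+∞`
  obtain ⟨φ, hφ, hdiv⟩ :=
    exists_subseq_tendsto_atTop_of_not_eventually_le (fun k => (reg.mcrit k - mc k) * reg.Zm k / reg.a k) hnot
  have hφt : Tendsto φ atTop atTop := hφ.tendsto_atTop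
  -- the body at the tuple `M + 1`, and two distinct flavours
  obtain ⟨z, shift, T, ⟨hAS, hbr, hconv⟩, -, -, hP, Δ, hΔ, hT, hL⟩ :=
    hbody (fun _ => M + 1) (fun _ => lt_add_one M)
  obtain ⟨f, g, hfg⟩ := exists_flavour_pair_ne hNf
  -- restrict everything to `φ` (every clause is a tail property of the index)
  set reg₁ : QCDRegularisation Nf := reg.restrict φ hφt with hreg₁
  have hms₁ : reg₁.HasMassScaling := by
    obtain ⟨c, hc, ht⟩ := hms
    exact ⟨c, hc, ht.comp hφt⟩
  have hcorner₁ : ∀ᶠ j in atTop, IsLUB {μ : ℝ | ¬ (∀ (R R' : ℕ) (A : QCDLatticeObservable Nf R)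
      (B : QCDLatticeObservable Nf R'), ∃ (C δ : ℝ) (S₀ : ℕ), 0 < δ ∧ ∀ S : ℕ, S₀ ≤ S → ∀ n : ℕ, n ≤ S →
        ‖qcdLatticeConnectedCorr (reg₁.β j) (2 * S + 1) (fun _ : Fin Nf => μ) A B n‖ ≤
          C * Real.exp (-(δ * n)))} ((mc ∘ φ) j) :=
    hφt.eventually hcorner
  have hmc₁ : Tendsto (mc ∘ φ) atTop (𝓝 0) := hmc.comp hφt
  have hoff₁ : Tendsto (fun j => (reg₁.mcrit j - (mc ∘ φ) j) * reg₁.Zm j / reg₁.a j) atTop atTop := hdiv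
  have hQ₁ : IsQCDAlong (reg₁.scheme (fun _ => M + 1) (fun s => z s ∘ φ) (fun s => shift s ∘ φ)) T := by
    refine ⟨?_, fun fl => hφt.eventually (hbr fl), fun n hn σ f F hF hoff => ?_⟩
    · obtain ⟨Λ, hΛ, ht⟩ := hAS
      exact ⟨Λ, hΛ, ht.comp hφt⟩
    · exact (hconv n hn σ f F hF hoff).comp hφt
  have hL₁ : (reg₁.scheme (fun _ => M + 1) (fun s => z s ∘ φ) (fun s => shift s ∘ φ)).HasLatticeMassGap Δ := by
    intro R R' A B
    obtain ⟨C, hC⟩ := hL R R' A B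
    exact ⟨C, hφt.eventually hC⟩
  -- decoupling along `φ` contradicts the non-triviality of the flavour-changing pseudoscalar
  exact hdec Nf hNf reg₁ (mc ∘ φ) (fun _ => M + 1) (fun s => z s ∘ φ) (fun s => shift s ∘ φ) T Δ f g hfg hΔ
    hms₁ hcorner₁ hmc₁ hoff₁ hQ₁ hL₁ hT (hP f g hfg)

end Summit.QuantumFields.QCD.Theorems.HonestHeavyAnchorUpperLocator

end
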